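import Summits.HodgeConjecture.CorCM.IrreducibleOddWeightsIsotypicFrobeniusIntertwining
import HarnessLib

/-!
# Isotypic cells, Frobenius IX: THE INVARIANTS OF A STABILISER ARE THE FUNCTIONS CONSTANT ON ITS ORBITS —
# `#(Stab(x₁)\Y₂) = Σ_c m_{1,c}·m_{2,c}·δ_c` (Burnside–Mackey orbit count over `ℚ`)

COR-CM (cell `pub-hodgecm2`, binder seat `b16` gen 77, count-neutral claim FROBENIUS RECIPROCITY IN THE REFERENCE
CURRENCY — MULTIPLICITIES FROM FIXED POINTS, file R9 — closes the loop of file R8: its left-hand side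
`dim (ℚ^{Y₂})^{Stab(x₁)}` is a pure orbit count; theorems only, no definition, no named fact, no `sorry`).  NEW as
stated, hence under `Summits/`.  HONEST FRAMING: the subspace of `ℚ^{Y₂}` fixed by the stabiliser `H = Stab(x₁)`
is the pull-back of `ℚ^{H\Y₂}` along the orbit map, so its dimension is the NUMBER OF `H`-ORBITS on `Y₂` (for
`G` acting on cosets: the number of double cosets `H₁\G/H₂`); with file R8 this number is
`Σ_c m_{1,c}·m_{2,c}·δ_c` — a COMBINATORIAL CHECK on any claimed isotypic data `(A_c, m_{i,c}, δ_c)` of the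
permutation modules `ℚ^{Hom(K_i, ℂ)}` (census side), and for `i₁ = i₂` the Hecke count `#(H\Y) = Σ_c m_c²·δ_c`.
Nothing about Hodge classes is asserted; `HC_CM` is neither used nor asserted.

* §1 **`finrank_fixed_eq_card_orbitRel_quotient`**: `dim F = #(Stab(x₁)\Y₂)` for the fixed subspace `F` of
  `Stab(x₁)` in `ℚ^{Y₂}` (any `G`-sets; `g ↦ g ∘ mk` is a linear isomorphism `ℚ^{H\Y₂} ≅ F`).
* §2 **`card_orbitRel_quotient_eq_sum`** (M-series data, two slots over shared references):
  `#(Stab(x₁)\Y₂) = Σ_c |J₁_c|·|J₂_c|·δ_c`; `card_orbitRel_quotient_eq_sum_sq` (`Y₁ = Y₂`).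
* §3 `exists_isotypic_card_orbitRel_quotient_eq_sum` (no input but the slots),
  `exists_isotypic_card_orbitRel_quotient_eq_sum_numberField` (number fields: the number of
  `Aut(ℂ/x₁K_{i₁})`-orbits on `Hom(K_{i₂}, ℂ)` is `Σ_c m_{i₁,c}·m_{i₂,c}·δ_c`).

## References

* [Serre1977] J.-P. Serre, *Linear Representations of Finite Groups*, GTM 42, §7.2 Thm. 13 and Ex. 7.2–7.3, Ex. 2.6
  (the character of a permutation representation counts fixed points; orbits).
* [LangeRodriguez2022] H. Lange, R. E. Rodríguez, *Decomposition of Jacobians by Prym Varieties*, LNM 2310 (2022),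
  §2.8 eq. (2.18) and Lemma 2.8.1.
-/

set_option autoImplicit false

noncomputable section

open scoped BigOperators Classical

universe u uC uJ uJ' v v' vC w

namespace Summit.HodgeConjecture.CorCM.IrrOdd

variable {G : Type w} [Group G]

/-! ### §1 The invariants of the stabiliser are the functions constant on its orbits -/

section Orbits

variable {Y₁ : Type v} [MulAction G Y₁] {Y₂ : Type v'} [MulAction G Y₂] [Fintype Y₂]

/-- **`dim (ℚ^{Y₂})^{Stab(x₁)} = #(Stab(x₁)\Y₂)`**: the subspace of `ℚ^{Y₂}` fixed by the stabiliser of `x₁` is the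
image of `ℚ^{Stab(x₁)\Y₂}` under the injective pull-back `g ↦ g ∘ mk` along the orbit map, whose range is exactly
the functions constant on the `Stab(x₁)`-orbits. [cite: Serre1977, §7.2 Ex. 7.2 and §2.3 Ex. 2.6] -/
theorem finrank_fixed_eq_card_orbitRel_quotient {x₁ : Y₁} {F : Submodule ℚ (Y₂ → ℚ)}
    (hF : ∀ f : Y₂ → ℚ, f ∈ F ↔ ∀ k : G, k • x₁ = x₁ → (fun y => f (k • y)) = f) :
    Module.finrank ℚ F = Fintype.card (MulAction.orbitRel.Quotient (MulAction.stabilizer G x₁) Y₂) := by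
  set H : Subgroup G := MulAction.stabilizer G x₁ with hH
  letI S : Setoid Y₂ := MulAction.orbitRel H Y₂
  let mk : Y₂ → MulAction.orbitRel.Quotient H Y₂ := Quotient.mk''
  let e : (MulAction.orbitRel.Quotient H Y₂ → ℚ) →ₗ[ℚ] (Y₂ → ℚ) := LinearMap.funLeft ℚ ℚ mk
  have he : ∀ g y, e g y = g (mk y) := fun g y => rfl
  -- the orbit map identifies `k • y` and `y` for `k` in the stabiliser
  have hmk : ∀ k : G, k • x₁ = x₁ → ∀ y : Y₂, mk (k • y) = mk y := by
    intro k hk y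
    refine Quotient.sound' ?_
    show k • y ∈ MulAction.orbit H y
    exact MulAction.mem_orbit_iff.2 ⟨⟨k, MulAction.mem_stabilizer_iff.2 hk⟩, rfl⟩
  have hrange : LinearMap.range e = F := by
    refine le_antisymm ?_ fun f hf => ?_
    · rintro _ ⟨g, rfl⟩
      refine (hF _).2 fun k hk => funext fun y => ?_
      rw [he, he, hmk k hk y]
    · -- `f` is constant on the orbits, hence a pull-back
      have hconst : ∀ a b : Y₂, a ≈ b → f a = f b := by
        intro a b hab
        have hab' : a ∈ MulAction.orbit H b := hab
        obtain ⟨h, rfl⟩ := MulAction.mem_orbit_iff.1 hab'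
        exact congrFun ((hF f).1 hf (h : G) (MulAction.mem_stabilizer_iff.1 h.2)) b
      exact ⟨Quotient.lift f hconst, funext fun y => rfl⟩
  have hsurj : Function.Surjective mk := fun q => Quotient.inductionOn' q fun y => ⟨y, rfl⟩
  have hinj : Function.Injective e := LinearMap.funLeft_injective_of_surjective ℚ ℚ mk hsurj
  rw [← hrange, LinearMap.finrank_range_of_inj hinj, Module.finrank_fintype_fun_eq_card]

end Orbits

/-! ### §2 The orbit count of two slots over shared references -/

section TwoSlots

variable {Y₁ : Type v} [MulAction G Y₁] [Fintype Y₁] {Y₂ : Type v'} [MulAction G Y₂] [Fintype Y₂]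
  {C : Type uC} [Fintype C] {Yc : C → Type vC} [∀ c, MulAction G (Yc c)] [∀ c, Fintype (Yc c)]
  {Ar : ∀ c, Submodule ℚ (Yc c → ℚ)} {𝒟 : ∀ c, Submodule ℚ ((Yc c → ℚ) →ₗ[ℚ] (Yc c → ℚ))}
  {J₁ : C → Type uJ} [∀ c, Fintype (J₁ c)] {J₂ : C → Type uJ'} [∀ c, Fintype (J₂ c)]

/-- **BURNSIDE–MACKEY OVER `ℚ`: `#(Stab(x₁)\Y₂) = Σ_c |J₁_c|·|J₂_c|·δ_c`** for two slots `Y₁ ∋ x₁` (transitive)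
and `Y₂` decomposed over the same pairwise non-embeddable references (file R8 + §1).
[cite: Serre1977, §7.2 Thm. 13 and Ex. 7.2–7.3] [cite: LangeRodriguez2022, §2.8 Lemma 2.8.1] -/
theorem card_orbitRel_quotient_eq_sum
    (h𝒟 : ∀ c (L : (Yc c → ℚ) →ₗ[ℚ] (Yc c → ℚ)), L ∈ 𝒟 c ↔ (∀ a ∈ Ar c, L a ∈ Ar c) ∧
      ∀ (k : G) (a : Yc c → ℚ), a ∈ Ar c → L (fun y => a (k • y)) = fun y => L a (k • y))
    (hRst : ∀ c (k : G) (a : Yc c → ℚ), a ∈ Ar c → (fun y => a (k • y)) ∈ Ar c)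
    (hRirr : ∀ c (W : Submodule ℚ (Yc c → ℚ)), W ≤ Ar c → W ≠ ⊥ →
      (∀ (k : G) (f : Yc c → ℚ), f ∈ W → (fun y => f (k • y)) ∈ W) → W = Ar c)
    (hsep : ∀ c c' (L : (Yc c → ℚ) →ₗ[ℚ] (Yc c' → ℚ)), c ≠ c' → Ar c ≠ ⊥ → (∀ a ∈ Ar c, L a ∈ Ar c') →
      (∀ a ∈ Ar c, L a = 0 → a = 0) →
      (∀ (k : G) (a : Yc c → ℚ), a ∈ Ar c → L (fun y => a (k • y)) = fun y => L a (k • y)) → False)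
    (ι₁ : ∀ c, J₁ c → ((Yc c → ℚ) →ₗ[ℚ] (Y₁ → ℚ)))
    (hι₁eq : ∀ c (j : J₁ c) (k : G) (a : Yc c → ℚ), a ∈ Ar c →
      ι₁ c j (fun y => a (k • y)) = fun y => ι₁ c j a (k • y))
    (hinj₁ : ∀ c (j : J₁ c) (a : Yc c → ℚ), a ∈ Ar c → ι₁ c j a = 0 → a = 0)
    (hindep₁ : iSupIndep fun q : (Σ c, J₁ c) => (Ar q.1).map (ι₁ q.1 q.2))
    (htop₁ : (⨆ c, ⨆ j, (Ar c).map (ι₁ c j)) = ⊤)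
    (ι₂ : ∀ c, J₂ c → ((Yc c → ℚ) →ₗ[ℚ] (Y₂ → ℚ)))
    (hι₂eq : ∀ c (j : J₂ c) (k : G) (a : Yc c → ℚ), a ∈ Ar c →
      ι₂ c j (fun y => a (k • y)) = fun y => ι₂ c j a (k • y))
    (hinj₂ : ∀ c (j : J₂ c) (a : Yc c → ℚ), a ∈ Ar c → ι₂ c j a = 0 → a = 0)
    (hindep₂ : iSupIndep fun q : (Σ c, J₂ c) => (Ar q.1).map (ι₂ q.1 q.2))
    (htop₂ : (⨆ c, ⨆ j, (Ar c).map (ι₂ c j)) = ⊤)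
    {a₀ : ∀ c, Yc c → ℚ} (ha₀ : ∀ c, a₀ c ∈ Ar c) (h0 : ∀ c, a₀ c ≠ 0)
    {x₁ : Y₁} (htr₁ : ∀ x : Y₁, ∃ g : G, g • x₁ = x) :
    Fintype.card (MulAction.orbitRel.Quotient (MulAction.stabilizer G x₁) Y₂) =
      ∑ c, Fintype.card (J₁ c) * Fintype.card (J₂ c) * Module.finrank ℚ ↥((𝒟 c).map (LinearMap.applyₗ (a₀ c))) := by
  obtain ⟨F, hF⟩ := exists_fixedSubmodule (G := G) (Y := Y₂) x₁
  rw [← finrank_fixed_eq_card_orbitRel_quotient hF]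
  exact finrank_fixed_eq_sum_card_mul_card_mul h𝒟 hRst hRirr hsep ι₁ hι₁eq hinj₁ hindep₁ htop₁ ι₂ hι₂eq hinj₂ hindep₂
    htop₂ ha₀ h0 htr₁ hF

variable {JJ : C → Type uJ} [∀ c, Fintype (JJ c)]

/-- **THE HECKE COUNT OF ONE SLOT: `#(Stab(x₀)\Y) = Σ_c |J_c|²·δ_c`** (the number of orbits of a point stabiliser,
for cosets the number of double cosets `H\G/H`, is the dimension of `End_G(ℚ^Y)`).
[cite: Serre1977, §7.2 Thm. 13 and Ex. 7.2–7.3] [cite: LangeRodriguez2022, §2.8 Lemma 2.8.1] -/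
theorem card_orbitRel_quotient_eq_sum_sq
    (h𝒟 : ∀ c (L : (Yc c → ℚ) →ₗ[ℚ] (Yc c → ℚ)), L ∈ 𝒟 c ↔ (∀ a ∈ Ar c, L a ∈ Ar c) ∧
      ∀ (k : G) (a : Yc c → ℚ), a ∈ Ar c → L (fun y => a (k • y)) = fun y => L a (k • y))
    (hRst : ∀ c (k : G) (a : Yc c → ℚ), a ∈ Ar c → (fun y => a (k • y)) ∈ Ar c)
    (hRirr : ∀ c (W : Submodule ℚ (Yc c → ℚ)), W ≤ Ar c → W ≠ ⊥ →
      (∀ (k : G) (f : Yc c → ℚ), f ∈ W → (fun y => f (k • y)) ∈ W) → W = Ar c)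
    (hsep : ∀ c c' (L : (Yc c → ℚ) →ₗ[ℚ] (Yc c' → ℚ)), c ≠ c' → Ar c ≠ ⊥ → (∀ a ∈ Ar c, L a ∈ Ar c') →
      (∀ a ∈ Ar c, L a = 0 → a = 0) →
      (∀ (k : G) (a : Yc c → ℚ), a ∈ Ar c → L (fun y => a (k • y)) = fun y => L a (k • y)) → False)
    (ι : ∀ c, JJ c → ((Yc c → ℚ) →ₗ[ℚ] (Y₁ → ℚ)))
    (hιeq : ∀ c (j : JJ c) (k : G) (a : Yc c → ℚ), a ∈ Ar c →
      ι c j (fun y => a (k • y)) = fun y => ι c j a (k • y))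
    (hinj : ∀ c (j : JJ c) (a : Yc c → ℚ), a ∈ Ar c → ι c j a = 0 → a = 0)
    (hindep : iSupIndep fun q : (Σ c, JJ c) => (Ar q.1).map (ι q.1 q.2))
    (htop : (⨆ c, ⨆ j, (Ar c).map (ι c j)) = ⊤)
    {a₀ : ∀ c, Yc c → ℚ} (ha₀ : ∀ c, a₀ c ∈ Ar c) (h0 : ∀ c, a₀ c ≠ 0)
    {x₀ : Y₁} (htr : ∀ x : Y₁, ∃ g : G, g • x₀ = x) :
    Fintype.card (MulAction.orbitRel.Quotient (MulAction.stabilizer G x₀) Y₁) =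
      ∑ c, Fintype.card (JJ c) ^ 2 * Module.finrank ℚ ↥((𝒟 c).map (LinearMap.applyₗ (a₀ c))) := by
  rw [card_orbitRel_quotient_eq_sum h𝒟 hRst hRirr hsep ι hιeq hinj hindep htop ι hιeq hinj hindep htop ha₀ h0 htr]
  exact Finset.sum_congr rfl fun c _ => by rw [sq]

end TwoSlots

/-! ### §3 With no input but the slots; number fields -/

section NoInput

variable {I : Type u} {E : I → Type v} [∀ i, MulAction G (E i)] [∀ i, Fintype (E i)] [Fintype I]

/-- **ORBIT COUNTS OF A FAMILY OF SLOTS, NO INPUT BUT THE SLOTS**: for finite `G`-sets `E_i` and the isotypic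
decomposition of gen 76 E3 (multiplicities `m_{i,c}`, commutants `𝒟_c`, non-zero `a₀_c`): for every slot `E_{i₁}`
transitive from `x₁` and every `i₂`, **`#(Stab(x₁)\E_{i₂}) = Σ_c m_{i₁,c}·m_{i₂,c}·δ_c`**.
[cite: Serre1977, §7.2 Thm. 13 and Ex. 7.2–7.3] [cite: LangeRodriguez2022, §2.8 Lemma 2.8.1] -/
theorem exists_isotypic_card_orbitRel_quotient_eq_sum :
    ∃ (n : ℕ) (Ar : Fin n → Submodule ℚ ((Σ i, E i) → ℚ))
      (𝒟 : Fin n → Submodule ℚ (((Σ i, E i) → ℚ) →ₗ[ℚ] ((Σ i, E i) → ℚ))) (m : I → Fin n → ℕ)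
      (ι : ∀ (i : I) (c : Fin n), Fin (m i c) → (((Σ i, E i) → ℚ) →ₗ[ℚ] (E i → ℚ)))
      (a₀ : Fin n → ((Σ i, E i) → ℚ)),
      (∀ (c : Fin n) (L : ((Σ i, E i) → ℚ) →ₗ[ℚ] ((Σ i, E i) → ℚ)), L ∈ 𝒟 c ↔ (∀ a ∈ Ar c, L a ∈ Ar c) ∧
        ∀ (k : G) (a : (Σ i, E i) → ℚ), a ∈ Ar c → L (fun x => a (k • x)) = fun x => L a (k • x)) ∧
      (∀ (c : Fin n) (k : G) (a : (Σ i, E i) → ℚ), a ∈ Ar c → (fun x => a (k • x)) ∈ Ar c) ∧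
      (∀ (c : Fin n) (W : Submodule ℚ ((Σ i, E i) → ℚ)), W ≤ Ar c → W ≠ ⊥ →
        (∀ (k : G) (f : (Σ i, E i) → ℚ), f ∈ W → (fun x => f (k • x)) ∈ W) → W = Ar c) ∧
      (∀ c : Fin n, Ar c ≠ ⊥) ∧
      (∀ (c c' : Fin n) (L : ((Σ i, E i) → ℚ) →ₗ[ℚ] ((Σ i, E i) → ℚ)), c ≠ c' → Ar c ≠ ⊥ →
        (∀ a ∈ Ar c, L a ∈ Ar c') → (∀ a ∈ Ar c, L a = 0 → a = 0) →
        (∀ (k : G) (a : (Σ i, E i) → ℚ), a ∈ Ar c → L (fun x => a (k • x)) = fun x => L a (k • x)) →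
        False) ∧
      (∀ (i : I) (c : Fin n) (j : Fin (m i c)) (k : G) (a : (Σ i, E i) → ℚ), a ∈ Ar c →
        ι i c j (fun x => a (k • x)) = fun s => ι i c j a (k • s)) ∧
      (∀ (i : I) (c : Fin n) (j : Fin (m i c)) (a : (Σ i, E i) → ℚ), a ∈ Ar c → ι i c j a = 0 → a = 0) ∧
      (∀ i : I, iSupIndep fun q : (Σ c : Fin n, Fin (m i c)) => (Ar q.1).map (ι i q.1 q.2)) ∧
      (∀ i : I, (⨆ c : Fin n, ⨆ j : Fin (m i c), (Ar c).map (ι i c j)) = ⊤) ∧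
      (∀ c, a₀ c ∈ Ar c) ∧ (∀ c, a₀ c ≠ 0) ∧
      ∀ (i₁ i₂ : I) (x₁ : E i₁), (∀ x : E i₁, ∃ g : G, g • x₁ = x) →
        Fintype.card (MulAction.orbitRel.Quotient (MulAction.stabilizer G x₁) (E i₂)) =
          ∑ c, m i₁ c * m i₂ c * Module.finrank ℚ ↥((𝒟 c).map (LinearMap.applyₗ (a₀ c))) := by
  obtain ⟨n, Ar, 𝒟, m, ι, a₀, h𝒟, hRst, hRirr, hR0, hsep, hιeq, hinj, hindep, htop, ha₀, h0, hint⟩ :=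
    exists_isotypic_finrank_fixed_eq_sum (G := G) (E := E)
  refine ⟨n, Ar, 𝒟, m, ι, a₀, h𝒟, hRst, hRirr, hR0, hsep, hιeq, hinj, hindep, htop, ha₀, h0,
    fun i₁ i₂ x₁ htr₁ => ?_⟩
  obtain ⟨F, hF⟩ := exists_fixedSubmodule (G := G) (Y := E i₂) x₁
  rw [← finrank_fixed_eq_card_orbitRel_quotient hF]
  exact hint i₁ i₂ x₁ htr₁ F hF

end NoInput

end Summit.HodgeConjecture.CorCM.IrrOdd

namespace Summit.HodgeConjecture.CorCM

open NumberField
open Literature.NumberTheory.ComplexMultiplication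
open Literature.AlgebraicGeometry.Pohlmann1968

variable {I : Type} [Fintype I] {K : I → Type} [∀ i, Field (K i)] [∀ i, NumberField (K i)]

/-- **THE NUMBER OF `Aut(ℂ/x₁K_{i₁})`-ORBITS ON `Hom(K_{i₂}, ℂ)` IS `Σ_c m_{i₁,c}·m_{i₂,c}·δ_c`** for the
`Aut(ℂ)`-isotypic decomposition `ℚ^{Hom(K_i, ℂ)} ≅ ⊕_c A_c^{m_{i,c}}` of a finite family of number fields
(commutants `𝒟_c`, non-zero `a₀_c`, `δ_c = dim 𝒟_c·a₀_c`); for `i₁ = i₂`, `Σ_c m_{i,c}²·δ_c` orbits.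
[cite: Serre1977, §7.2 Thm. 13 and Ex. 7.2–7.3] [cite: LangeRodriguez2022, §2.8 Lemma 2.8.1] -/
theorem exists_isotypic_card_orbitRel_quotient_eq_sum_numberField :
    ∃ (n : ℕ) (Ar : Fin n → Submodule ℚ ((Σ i, (K i →+* ℂ)) → ℚ))
      (𝒟 : Fin n → Submodule ℚ (((Σ i, (K i →+* ℂ)) → ℚ) →ₗ[ℚ] ((Σ i, (K i →+* ℂ)) → ℚ)))
      (m : I → Fin n → ℕ)
      (ι : ∀ (i : I) (c : Fin n), Fin (m i c) → (((Σ i, (K i →+* ℂ)) → ℚ) →ₗ[ℚ] ((K i →+* ℂ) → ℚ)))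
      (a₀ : Fin n → ((Σ i, (K i →+* ℂ)) → ℚ)),
      (∀ (c : Fin n) (L : ((Σ i, (K i →+* ℂ)) → ℚ) →ₗ[ℚ] ((Σ i, (K i →+* ℂ)) → ℚ)), L ∈ 𝒟 c ↔
        (∀ a ∈ Ar c, L a ∈ Ar c) ∧ ∀ (k : ℂ ≃+* ℂ) (a : (Σ i, (K i →+* ℂ)) → ℚ), a ∈ Ar c →
          L (fun x => a (k • x)) = fun x => L a (k • x)) ∧
      (∀ (c : Fin n) (k : ℂ ≃+* ℂ) (a : (Σ i, (K i →+* ℂ)) → ℚ), a ∈ Ar c → (fun x => a (k • x)) ∈ Ar c) ∧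
      (∀ (c : Fin n) (W : Submodule ℚ ((Σ i, (K i →+* ℂ)) → ℚ)), W ≤ Ar c → W ≠ ⊥ →
        (∀ (k : ℂ ≃+* ℂ) (f : (Σ i, (K i →+* ℂ)) → ℚ), f ∈ W → (fun x => f (k • x)) ∈ W) → W = Ar c) ∧
      (∀ c : Fin n, Ar c ≠ ⊥) ∧
      (∀ (c c' : Fin n) (L : ((Σ i, (K i →+* ℂ)) → ℚ) →ₗ[ℚ] ((Σ i, (K i →+* ℂ)) → ℚ)), c ≠ c' → Ar c ≠ ⊥ →
        (∀ a ∈ Ar c, L a ∈ Ar c') → (∀ a ∈ Ar c, L a = 0 → a = 0) →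
        (∀ (k : ℂ ≃+* ℂ) (a : (Σ i, (K i →+* ℂ)) → ℚ), a ∈ Ar c →
          L (fun x => a (k • x)) = fun x => L a (k • x)) → False) ∧
      (∀ (i : I) (c : Fin n) (j : Fin (m i c)) (k : ℂ ≃+* ℂ) (a : (Σ i, (K i →+* ℂ)) → ℚ), a ∈ Ar c →
        ι i c j (fun x => a (k • x)) = fun s => ι i c j a (k • s)) ∧
      (∀ (i : I) (c : Fin n) (j : Fin (m i c)) (a : (Σ i, (K i →+* ℂ)) → ℚ), a ∈ Ar c →
        ι i c j a = 0 → a = 0) ∧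
      (∀ i : I, iSupIndep fun q : (Σ c : Fin n, Fin (m i c)) => (Ar q.1).map (ι i q.1 q.2)) ∧
      (∀ i : I, (⨆ c : Fin n, ⨆ j : Fin (m i c), (Ar c).map (ι i c j)) = ⊤) ∧
      (∀ c, a₀ c ∈ Ar c) ∧ (∀ c, a₀ c ≠ 0) ∧
      ∀ (i₁ i₂ : I) (x₁ : K i₁ →+* ℂ),
        Fintype.card (MulAction.orbitRel.Quotient (MulAction.stabilizer (ℂ ≃+* ℂ) x₁) (K i₂ →+* ℂ)) =
          ∑ c, m i₁ c * m i₂ c * Module.finrank ℚ ↥((𝒟 c).map (LinearMap.applyₗ (a₀ c))) := by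
  obtain ⟨n, Ar, 𝒟, m, ι, a₀, h𝒟, hRst, hRirr, hR0, hsep, hιeq, hinj, hindep, htop, ha₀, h0, horb⟩ :=
    IrrOdd.exists_isotypic_card_orbitRel_quotient_eq_sum (G := ℂ ≃+* ℂ) (E := fun i => K i →+* ℂ)
  exact ⟨n, Ar, 𝒟, m, ι, a₀, h𝒟, hRst, hRirr, hR0, hsep, hιeq, hinj, hindep, htop, ha₀, h0,
    fun i₁ i₂ x₁ => horb i₁ i₂ x₁ (exists_smul_embedding_eq x₁)⟩

end Summit.HodgeConjecture.CorCM

end
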